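import Literature.Analysis.FluidPDE.JetStepTheorem
import HarnessLib

/-!
# The intermittent-jet step: power-counting calculus and the parameter choice (BV §7.7)

Analysis/FluidPDE support file (everything proved): a small calculus of bounds
`|X| ≤ K L^e` ("`Bnd L X K e`", pointwise) and of UNIFORM bounds of a size function of the step
parameters ("`UBnd T S e`": one constant `K` for all admissible parameters in the regime below),
closed under products, sums, powers and square roots (the exponent of such a bound of any
polynomial size expression is computed structurally by `repeat' (first | leaf | rule)`), and its
application to the size functions of `JetStepTheorem` under the parameter choice `σ = L^{3/16}`, `κ = L^{1/2}`,
`μ = L^{13/16}`, `μ′ = L^{5/4}`, `ℓ = L^{-1/16}` (`L = λ_{q+1}`), `γ₀ = δ_{q+1}`, `V = λ_q⁴`,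
`A = λ_q^{10}`, `λ_q ≤ L^{1/b₀}`: for `L ≥ L₀` the step of `JetStep.jet_step` has `L²` increment
`≤ M δ_{q+1}^{1/2}` (`M` absolute), new `L¹` stress `≤ L^{-11/200}`, new sup stress `≤ L^{10}` and
`C¹` size `≤ L⁴` (`JetStep.step_arith`; Buckmaster–Vicol, EMS Surv. Math. Sci. 6 (2019), §7.7
"choice of parameters", adapted to the present bookkeeping; Ann. of Math. 189 (2019), §2.1–2.3).

## References

* T. Buckmaster, V. Vicol, EMS Surv. Math. Sci. 6 (2019) = arXiv:1901.09023, §7.7. [`BuckmasterVicol2020`]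
* T. Buckmaster, V. Vicol, Ann. of Math. 189 (2019) = arXiv:1709.10033, §2.1–2.3. [`BuckmasterVicol2019Annals`]
-/

noncomputable section

open MeasureTheory Set Filter Topology Function
open scoped InnerProductSpace ContDiff ENNReal NNReal

namespace Literature.Analysis.FluidPDE

namespace JetStep

open Literature.Analysis.FunctionSpaces FunctionSpaces.Torus Mikado NashGeometric Jet

/-! ## The pointwise calculus of power bounds -/

/-- `Bnd L X K e`: `0 ≤ K` and `|X| ≤ K L^e`. [folklore] -/
def Bnd (L X K e : ℝ) : Prop := 0 ≤ K ∧ |X| ≤ K * L ^ e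

namespace Bnd

variable {L X Y K K₁ K₂ e e₁ e₂ e' k r : ℝ}

/-- The one-sided bound. [folklore] -/
theorem le (h : Bnd L X K e) : X ≤ K * L ^ e := (le_abs_self X).trans h.2

/-- Products. [folklore] -/
theorem mul (hL : 1 ≤ L) (h₁ : Bnd L X K₁ e₁) (h₂ : Bnd L Y K₂ e₂) : Bnd L (X * Y) (K₁ * K₂) (e₁ + e₂) := by
  have hL0 : 0 < L := by linarith
  refine ⟨mul_nonneg h₁.1 h₂.1, ?_⟩
  rw [abs_mul, Real.rpow_add hL0]
  calc |X| * |Y| ≤ (K₁ * L ^ e₁) * (K₂ * L ^ e₂) := mul_le_mul h₁.2 h₂.2 (abs_nonneg _) (by have := h₁.1; positivity)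
    _ = K₁ * K₂ * (L ^ e₁ * L ^ e₂) := by ring

/-- Monotonicity in the exponent (`L ≥ 1`). [folklore] -/
theorem mono (hL : 1 ≤ L) (h : Bnd L X K e) (he : e ≤ e') : Bnd L X K e' :=
  ⟨h.1, h.2.trans (mul_le_mul_of_nonneg_left (Real.rpow_le_rpow_of_exponent_le hL he) h.1)⟩

/-- Sums. [folklore] -/
theorem add (hL : 1 ≤ L) (h₁ : Bnd L X K₁ e₁) (h₂ : Bnd L Y K₂ e₂) : Bnd L (X + Y) (K₁ + K₂) (max e₁ e₂) := by
  have a := (h₁.mono hL (le_max_left e₁ e₂)).2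
  have b := (h₂.mono hL (le_max_right e₁ e₂)).2
  refine ⟨add_nonneg h₁.1 h₂.1, (abs_add_le _ _).trans ?_⟩
  calc |X| + |Y| ≤ K₁ * L ^ max e₁ e₂ + K₂ * L ^ max e₁ e₂ := add_le_add a b
    _ = (K₁ + K₂) * L ^ max e₁ e₂ := by ring

/-- Differences. [folklore] -/
theorem sub (hL : 1 ≤ L) (h₁ : Bnd L X K₁ e₁) (h₂ : Bnd L Y K₂ e₂) : Bnd L (X - Y) (K₁ + K₂) (max e₁ e₂) := by
  have h₂' : Bnd L (-Y) K₂ e₂ := ⟨h₂.1, by rw [abs_neg]; exact h₂.2⟩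
  simpa [sub_eq_add_neg] using h₁.add hL h₂'

/-- Natural powers. [folklore] -/
theorem pow (hL : 1 ≤ L) (h : Bnd L X K e) (n : ℕ) : Bnd L (X ^ n) (K ^ n) (n * e) := by
  have hL0 : 0 < L := by linarith
  refine ⟨pow_nonneg h.1 n, ?_⟩
  rw [abs_pow, mul_comm (n : ℝ) e, Real.rpow_mul_natCast hL0.le, ← mul_pow]
  exact pow_le_pow_left₀ (abs_nonneg _) h.2 n

/-- Real powers with nonnegative exponent. [folklore] -/
theorem rpow (hL : 1 ≤ L) (h : Bnd L X K e) (hr : 0 ≤ r) : Bnd L (X ^ r) (K ^ r) (e * r) := by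
  have hL0 : 0 < L := by linarith
  refine ⟨Real.rpow_nonneg h.1 r, ?_⟩
  calc |X ^ r| ≤ |X| ^ r := Real.abs_rpow_le_abs_rpow X r
    _ ≤ (K * L ^ e) ^ r := Real.rpow_le_rpow (abs_nonneg X) h.2 hr
    _ = K ^ r * L ^ (e * r) := by rw [Real.mul_rpow h.1 (Real.rpow_nonneg hL0.le e), Real.rpow_mul hL0.le]

/-- Square roots. [folklore] -/
theorem sqrt (hL : 1 ≤ L) (h : Bnd L X K e) : Bnd L (Real.sqrt X) (Real.sqrt K) (e / 2) := by
  have hL0 : 0 < L := by linarith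
  refine ⟨Real.sqrt_nonneg _, ?_⟩
  rw [abs_of_nonneg (Real.sqrt_nonneg _)]
  have h1 : Real.sqrt X ≤ Real.sqrt |X| := Real.sqrt_le_sqrt (le_abs_self X)
  have h2 : Real.sqrt |X| ≤ Real.sqrt (K * L ^ e) := Real.sqrt_le_sqrt h.2
  refine h1.trans (h2.trans (le_of_eq ?_))
  rw [Real.sqrt_mul h.1, Real.sqrt_eq_rpow (L ^ e), ← Real.rpow_mul hL0.le]
  congr 1; ring_nf

/-- Inverses of exact powers. [folklore] -/
theorem inv_eq (hL : 1 ≤ L) (hX : X = L ^ k) : Bnd L X⁻¹ 1 (-k) := by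
  have hL0 : 0 < L := by linarith
  refine ⟨zero_le_one, ?_⟩
  rw [hX, ← Real.rpow_neg hL0.le, abs_of_nonneg (Real.rpow_nonneg hL0.le _), one_mul]

/-- Exact powers. [folklore] -/
theorem of_eq (hL : 1 ≤ L) (hX : X = L ^ k) : Bnd L X 1 k := by
  have hL0 : 0 < L := by linarith
  exact ⟨zero_le_one, by rw [hX, abs_of_nonneg (Real.rpow_nonneg hL0.le _), one_mul]⟩

/-- Real powers of exact powers. [folklore] -/
theorem rpow_eq (hL : 1 ≤ L) (hX : X = L ^ k) (r : ℝ) : Bnd L (X ^ r) 1 (k * r) := by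
  have hL0 : 0 < L := by linarith
  refine of_eq hL ?_
  rw [hX, ← Real.rpow_mul hL0.le]

/-- Natural powers of exact powers. [folklore] -/
theorem npow_eq (hL : 1 ≤ L) (hX : X = L ^ k) (n : ℕ) : Bnd L (X ^ n) 1 (k * n) := by
  have hL0 : 0 < L := by linarith
  refine of_eq hL ?_
  rw [hX, ← Real.rpow_mul_natCast hL0.le]

/-- Constants. [folklore] -/
theorem const (L c : ℝ) : Bnd L c |c| 0 :=
  ⟨abs_nonneg c, by rw [Real.rpow_zero, mul_one]⟩

/-- From a one-sided bound of a nonnegative quantity. [folklore] -/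
theorem of_nonneg_le (h0 : 0 ≤ X) (hK : 0 ≤ K) (h : X ≤ K * L ^ e) : Bnd L X K e :=
  ⟨hK, by rwa [abs_of_nonneg h0]⟩

/-- `max 1 X`. [folklore] -/
theorem max_one (hL : 1 ≤ L) (h : Bnd L X K e) (he : 0 ≤ e) : Bnd L (max 1 X) (1 + K) e := by
  refine ⟨by linarith [h.1], ?_⟩
  have hLe : 1 ≤ L ^ e := Real.one_le_rpow hL he
  rw [abs_le]
  constructor
  · have : 0 ≤ (1 + K) * L ^ e := by have := h.1; positivity
    linarith [le_max_left 1 X]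
  · refine max_le ?_ ?_
    · nlinarith [h.1]
    · have := (abs_le.1 h.2).2; nlinarith [h.1]

/-- The final comparison: `X ≤ L^{e + m}` once `K ≤ L^m`. [folklore] -/
theorem le_rpow (hL : 1 ≤ L) (h : Bnd L X K e) {m : ℝ} (hK : K ≤ L ^ m) : X ≤ L ^ (e + m) := by
  have hL0 : 0 < L := by linarith
  calc X ≤ |X| := le_abs_self X
    _ ≤ K * L ^ e := h.2
    _ ≤ L ^ m * L ^ e := mul_le_mul_of_nonneg_right hK (Real.rpow_nonneg hL0.le _)
    _ = L ^ (e + m) := by rw [Real.rpow_add hL0, mul_comm]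

/-- The same with a prescribed target exponent. [folklore] -/
theorem le_rpow_of_le (hL : 1 ≤ L) (h : Bnd L X K e) {m t : ℝ} (hK : K ≤ L ^ m) (het : e + m ≤ t) : X ≤ L ^ t :=
  (h.le_rpow hL hK).trans (Real.rpow_le_rpow_of_exponent_le hL het)

/-- Absorbing a constant: `K ≤ L^m` as soon as `L ≥ max 1 K ^ (1/m)` (`m > 0`). [folklore] -/
theorem const_le_rpow {K L m : ℝ} (hm : 0 < m) (hL : (max 1 K) ^ (1 / m) ≤ L) : K ≤ L ^ m := by
  have h1 : 1 ≤ max 1 K := le_max_left _ _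
  have h0 : 0 ≤ (max 1 K) ^ (1 / m) := Real.rpow_nonneg (by linarith) _
  calc K ≤ max 1 K := le_max_right _ _
    _ = ((max 1 K) ^ (1 / m)) ^ m := by rw [← Real.rpow_mul (by linarith), one_div_mul_cancel hm.ne', Real.rpow_one]
    _ ≤ L ^ m := Real.rpow_le_rpow h0 hL hm.le

/-- The absorption threshold is `≥ 1`. [folklore] -/
theorem one_le_threshold (K : ℝ) {m : ℝ} (hm : 0 < m) : 1 ≤ (max 1 K) ^ (1 / m) :=
  Real.one_le_rpow (le_max_left _ _) (by positivity)

end Bnd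

/-! ## The parameter regime -/

/-- The reference lower bound `b₀ = 20000` for the super-exponent `b` (any larger works). [folklore] -/
def B0 : ℝ := 20000

/-- **The parameter regime of the step at frequency `L = λ_{q+1}`** (`lam = λ_q ≤ L^{1/b₀}`):
`σ = L^{3/16}`, `κ = L^{1/2}`, `μ = L^{13/16}`, `μ′ = L^{5/4}`, `ℓ = L^{-1/16}`, `V = λ_q⁴`,
`A = λ_q^{10}`, `δ ≤ γ₀ ≤ 1`, `γ₀ ≥ L^{-1/(20b₀)}`. [cite: BuckmasterVicol2020, §7.7] -/
structure StepPars.Regime (P : StepPars) (L lam : ℝ) : Prop where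
  hL : 1 ≤ L
  hlam : 1 ≤ lam
  hlamL : lam ≤ L ^ (1 / B0)
  hσ : (P.σ : ℝ) = L ^ (3 / 16 : ℝ)
  hκ : P.κ = L ^ (1 / 2 : ℝ)
  hμ : P.μ = L ^ (13 / 16 : ℝ)
  hmup : P.mup = L ^ (5 / 4 : ℝ)
  hℓ : P.ℓ = L ^ (-(1 / 16 : ℝ))
  hV : P.V = lam ^ 4
  hA : P.A = lam ^ 10
  hδγ : P.δ ≤ P.γ₀
  hγ1 : P.γ₀ ≤ 1
  hγlow : L ^ (-(1 / (20 * B0))) ≤ P.γ₀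

namespace StepPars

variable {P : StepPars} {L lam : ℝ}

/-- Unfolding of the datum. [folklore] -/
theorem D_σ : P.D.σ = P.σ := rfl
/-- Unfolding of the datum. [folklore] -/
theorem D_κ : P.D.κ = P.κ := rfl
/-- Unfolding of the datum. [folklore] -/
theorem D_μ : P.D.μ = P.μ := rfl
/-- Unfolding of the datum. [folklore] -/
theorem D_mup : P.D.mup = P.mup := rfl

/-- `Θ = L^{1/16}`. [folklore] -/
theorem Regime.hΘ (hR : P.Regime L lam) : P.Θ = L ^ (1 / 16 : ℝ) := by
  have hL0 : 0 < L := by linarith [hR.hL]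
  show P.ℓ⁻¹ = _
  rw [hR.hℓ, Real.rpow_neg hL0.le, inv_inv]

/-- `λ_q^n ≤ L^{n/b₀}`. [folklore] -/
theorem Regime.lam_pow_le (hR : P.Regime L lam) (n : ℕ) : lam ^ n ≤ L ^ ((n : ℝ) / B0) := by
  have hL0 : 0 < L := by linarith [hR.hL]
  rw [show (n : ℝ) / B0 = (1 / B0) * n by ring, Real.rpow_mul_natCast hL0.le]
  exact pow_le_pow_left₀ (by linarith [hR.hlam]) hR.hlamL n

/-- `γ₀⁻¹ ≤ L^{1/(20 b₀)}`. [folklore] -/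
theorem Regime.inv_γ_le (hP : P.Valid) (hR : P.Regime L lam) : P.γ₀⁻¹ ≤ L ^ (1 / (20 * B0)) := by
  have hL0 : 0 < L := by linarith [hR.hL]
  have h1 : P.γ₀⁻¹ ≤ (L ^ (-(1 / (20 * B0))))⁻¹ := (inv_le_inv₀ hP.hγ (Real.rpow_pos_of_pos hL0 _)).2 hR.hγlow
  rwa [← Real.rpow_neg hL0.le, neg_neg] at h1

/-- `√γ₀ ≥ L^{-1/(40 b₀)}`. [folklore] -/
theorem Regime.rpow_le_sqrt_γ (hR : P.Regime L lam) : L ^ (-(1 / (40 * B0))) ≤ Real.sqrt P.γ₀ := by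
  have hL0 : 0 < L := by linarith [hR.hL]
  have h := Real.sqrt_le_sqrt hR.hγlow
  rwa [Real.sqrt_eq_rpow, ← Real.rpow_mul hL0.le, show -(1 / (20 * B0)) * (1 / 2 : ℝ) = -(1 / (40 * B0)) by ring] at h

end StepPars

/-! ## Uniform power bounds of size functions of the parameters -/

/-- `UBnd T S e`: the size function `S` of the step parameters is bounded by `K L^e` with ONE
constant `K ≥ 0` for all admissible parameters of time horizon `T` in the regime at frequency `L`.
[folklore] -/
def UBnd (T : ℝ) (S : StepPars → ℝ) (e : ℝ) : Prop :=
  ∃ K, 0 ≤ K ∧ ∀ ⦃P : StepPars⦄ ⦃L lam : ℝ⦄, P.Valid → P.Regime L lam → P.T = T → |S P| ≤ K * L ^ e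

namespace UBnd

variable {T : ℝ} {S R : StepPars → ℝ} {e e₁ e₂ e' r : ℝ}

/-- Pointwise form. [folklore] -/
theorem bnd (h : UBnd T S e) :
    ∃ K, 0 ≤ K ∧ ∀ ⦃P : StepPars⦄ ⦃L lam : ℝ⦄, P.Valid → P.Regime L lam → P.T = T → Bnd L (S P) K e := by
  obtain ⟨K, hK, h⟩ := h
  exact ⟨K, hK, fun _ _ _ hP hR hT => ⟨hK, h hP hR hT⟩⟩

/-- From the pointwise form. [folklore] -/
theorem of_bnd {K : ℝ} (hK : 0 ≤ K)
    (h : ∀ ⦃P : StepPars⦄ ⦃L lam : ℝ⦄, P.Valid → P.Regime L lam → P.T = T → Bnd L (S P) K e) : UBnd T S e :=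
  ⟨K, hK, fun _ _ _ hP hR hT => (h hP hR hT).2⟩

/-- Products. [folklore] -/
theorem mul (h₁ : UBnd T S e₁) (h₂ : UBnd T R e₂) : UBnd T (fun P => S P * R P) (e₁ + e₂) := by
  obtain ⟨K₁, hK₁, h₁⟩ := h₁.bnd
  obtain ⟨K₂, hK₂, h₂⟩ := h₂.bnd
  exact of_bnd (mul_nonneg hK₁ hK₂) fun _ _ _ hP hR hT => (h₁ hP hR hT).mul hR.hL (h₂ hP hR hT)

/-- Sums. [folklore] -/
theorem add (h₁ : UBnd T S e₁) (h₂ : UBnd T R e₂) : UBnd T (fun P => S P + R P) (max e₁ e₂) := by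
  obtain ⟨K₁, hK₁, h₁⟩ := h₁.bnd
  obtain ⟨K₂, hK₂, h₂⟩ := h₂.bnd
  exact of_bnd (add_nonneg hK₁ hK₂) fun _ _ _ hP hR hT => (h₁ hP hR hT).add hR.hL (h₂ hP hR hT)

/-- Differences. [folklore] -/
theorem sub (h₁ : UBnd T S e₁) (h₂ : UBnd T R e₂) : UBnd T (fun P => S P - R P) (max e₁ e₂) := by
  obtain ⟨K₁, hK₁, h₁⟩ := h₁.bnd
  obtain ⟨K₂, hK₂, h₂⟩ := h₂.bnd
  exact of_bnd (add_nonneg hK₁ hK₂) fun _ _ _ hP hR hT => (h₁ hP hR hT).sub hR.hL (h₂ hP hR hT)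

/-- Natural powers. [folklore] -/
theorem pow {n : ℕ} (h : UBnd T S e) : UBnd T (fun P => S P ^ n) (n * e) := by
  obtain ⟨K, hK, h⟩ := h.bnd
  exact of_bnd (pow_nonneg hK n) fun _ _ _ hP hR hT => (h hP hR hT).pow hR.hL n

/-- Real powers with nonnegative exponent. [folklore] -/
theorem rpow (h : UBnd T S e) (hr : 0 ≤ r) : UBnd T (fun P => S P ^ r) (e * r) := by
  obtain ⟨K, hK, h⟩ := h.bnd
  exact of_bnd (Real.rpow_nonneg hK r) fun _ _ _ hP hR hT => (h hP hR hT).rpow hR.hL hr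

/-- Square roots. [folklore] -/
theorem sqrt (h : UBnd T S e) : UBnd T (fun P => Real.sqrt (S P)) (e / 2) := by
  obtain ⟨K, hK, h⟩ := h.bnd
  exact of_bnd (Real.sqrt_nonneg K) fun _ _ _ hP hR hT => (h hP hR hT).sqrt hR.hL

/-- Constants. [folklore] -/
theorem const (T x : ℝ) : UBnd T (fun _ => x) 0 :=
  of_bnd (abs_nonneg x) fun _ L _ _ _ _ => Bnd.const L x

/-- Monotonicity in the exponent. [folklore] -/
theorem mono (h : UBnd T S e) (he : e ≤ e') : UBnd T S e' := by
  obtain ⟨K, hK, h⟩ := h.bnd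
  exact of_bnd hK fun _ _ _ hP hR hT => (h hP hR hT).mono hR.hL he

/-- `max 1 S`. [folklore] -/
theorem max_one (h : UBnd T S e) (he : 0 ≤ e) : UBnd T (fun P => max 1 (S P)) e := by
  obtain ⟨K, hK, h⟩ := h.bnd
  exact of_bnd (by linarith) fun _ _ _ hP hR hT => (h hP hR hT).max_one hR.hL he

/-! ### The leaves -/

/-- `σ^r`. [folklore] -/
theorem σr (T r : ℝ) : UBnd T (fun P => (P.σ : ℝ) ^ r) (3 / 16 * r) :=
  of_bnd zero_le_one fun _ _ _ _ hR _ => Bnd.rpow_eq hR.hL hR.hσ r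
/-- `κ^r`. [folklore] -/
theorem κr (T r : ℝ) : UBnd T (fun P => P.κ ^ r) (1 / 2 * r) :=
  of_bnd zero_le_one fun _ _ _ _ hR _ => Bnd.rpow_eq hR.hL hR.hκ r
/-- `μ^r`. [folklore] -/
theorem μr (T r : ℝ) : UBnd T (fun P => P.μ ^ r) (13 / 16 * r) :=
  of_bnd zero_le_one fun _ _ _ _ hR _ => Bnd.rpow_eq hR.hL hR.hμ r
/-- `σ^n`. [folklore] -/
theorem σn (T : ℝ) (n : ℕ) : UBnd T (fun P => (P.σ : ℝ) ^ n) (3 / 16 * n) :=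
  of_bnd zero_le_one fun _ _ _ _ hR _ => Bnd.npow_eq hR.hL hR.hσ n
/-- `κ^n`. [folklore] -/
theorem κn (T : ℝ) (n : ℕ) : UBnd T (fun P => P.κ ^ n) (1 / 2 * n) :=
  of_bnd zero_le_one fun _ _ _ _ hR _ => Bnd.npow_eq hR.hL hR.hκ n
/-- `μ^n`. [folklore] -/
theorem μn (T : ℝ) (n : ℕ) : UBnd T (fun P => P.μ ^ n) (13 / 16 * n) :=
  of_bnd zero_le_one fun _ _ _ _ hR _ => Bnd.npow_eq hR.hL hR.hμ n
/-- `σ`. [folklore] -/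
theorem σ (T : ℝ) : UBnd T (fun P => (P.σ : ℝ)) (3 / 16) :=
  of_bnd zero_le_one fun _ _ _ _ hR _ => Bnd.of_eq hR.hL hR.hσ
/-- `κ`. [folklore] -/
theorem κ (T : ℝ) : UBnd T (fun P => P.κ) (1 / 2) :=
  of_bnd zero_le_one fun _ _ _ _ hR _ => Bnd.of_eq hR.hL hR.hκ
/-- `μ`. [folklore] -/
theorem μ (T : ℝ) : UBnd T (fun P => P.μ) (13 / 16) :=
  of_bnd zero_le_one fun _ _ _ _ hR _ => Bnd.of_eq hR.hL hR.hμ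
/-- `μ′`. [folklore] -/
theorem mup (T : ℝ) : UBnd T (fun P => P.mup) (5 / 4) :=
  of_bnd zero_le_one fun _ _ _ _ hR _ => Bnd.of_eq hR.hL hR.hmup
/-- `σ⁻¹`. [folklore] -/
theorem σi (T : ℝ) : UBnd T (fun P => (P.σ : ℝ)⁻¹) (-(3 / 16)) :=
  of_bnd zero_le_one fun _ _ _ _ hR _ => Bnd.inv_eq hR.hL hR.hσ
/-- `κ⁻¹`. [folklore] -/
theorem κi (T : ℝ) : UBnd T (fun P => P.κ⁻¹) (-(1 / 2)) :=
  of_bnd zero_le_one fun _ _ _ _ hR _ => Bnd.inv_eq hR.hL hR.hκ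
/-- `μ⁻¹`. [folklore] -/
theorem μi (T : ℝ) : UBnd T (fun P => P.μ⁻¹) (-(13 / 16)) :=
  of_bnd zero_le_one fun _ _ _ _ hR _ => Bnd.inv_eq hR.hL hR.hμ
/-- `μ′⁻¹`. [folklore] -/
theorem mupi (T : ℝ) : UBnd T (fun P => P.mup⁻¹) (-(5 / 4)) :=
  of_bnd zero_le_one fun _ _ _ _ hR _ => Bnd.inv_eq hR.hL hR.hmup
/-- `ℓ`. [folklore] -/
theorem ℓ (T : ℝ) : UBnd T (fun P => P.ℓ) (-(1 / 16)) :=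
  of_bnd zero_le_one fun _ _ _ _ hR _ => Bnd.of_eq hR.hL hR.hℓ
/-- `Θ`. [folklore] -/
theorem Θ (T : ℝ) : UBnd T (fun P => P.Θ) (1 / 16) :=
  of_bnd zero_le_one fun _ _ _ _ hR _ => Bnd.of_eq hR.hL hR.hΘ
/-- `V`. [folklore] -/
theorem V (T : ℝ) : UBnd T (fun P => P.V) (4 / B0) :=
  of_bnd zero_le_one fun _ _ _ hP hR _ => by
    refine Bnd.of_nonneg_le (by linarith [hP.hV]) zero_le_one ?_
    rw [one_mul, hR.hV]
    exact_mod_cast hR.lam_pow_le 4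
/-- `A`. [folklore] -/
theorem A (T : ℝ) : UBnd T (fun P => P.A) (10 / B0) :=
  of_bnd zero_le_one fun _ _ _ hP hR _ => by
    refine Bnd.of_nonneg_le (by linarith [hP.hA]) zero_le_one ?_
    rw [one_mul, hR.hA]
    exact_mod_cast hR.lam_pow_le 10
/-- `γ₀`. [folklore] -/
theorem γ (T : ℝ) : UBnd T (fun P => P.γ₀) 0 :=
  of_bnd zero_le_one fun _ _ _ hP hR _ =>
    Bnd.of_nonneg_le hP.hγ.le zero_le_one (by rw [Real.rpow_zero, one_mul]; exact hR.hγ1)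
/-- `δ`. [folklore] -/
theorem δ (T : ℝ) : UBnd T (fun P => P.δ) 0 :=
  of_bnd zero_le_one fun _ _ _ hP hR _ =>
    Bnd.of_nonneg_le hP.hδ.le zero_le_one (by rw [Real.rpow_zero, one_mul]; exact hR.hδγ.trans hR.hγ1)
/-- `γ₀⁻¹`. [folklore] -/
theorem γi (T : ℝ) : UBnd T (fun P => P.γ₀⁻¹) (1 / (20 * B0)) :=
  of_bnd zero_le_one fun _ _ _ hP hR _ =>
    Bnd.of_nonneg_le (inv_pos.2 hP.hγ).le zero_le_one (by rw [one_mul]; exact hR.inv_γ_le hP)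
/-- `T⁻¹` (the only `T`-dependent constant). [folklore] -/
theorem Ti (T : ℝ) : UBnd T (fun P => P.T⁻¹) 0 :=
  of_bnd (abs_nonneg T⁻¹) fun _ L _ _ _ hT => by rw [hT]; exact Bnd.const L T⁻¹

/-! ### Extraction -/

/-- **The final comparison**: `S ≤ L^t` for `L ≥ L₀ = max 1 K ^ (1/m)` whenever `e + m ≤ t`,
`m > 0`. [folklore] -/
theorem le_rpow (h : UBnd T S e) {m t : ℝ} (hm : 0 < m) (het : e + m ≤ t) :
    ∃ L₀, 1 ≤ L₀ ∧ ∀ ⦃P : StepPars⦄ ⦃L lam : ℝ⦄, P.Valid → P.Regime L lam → P.T = T → L₀ ≤ L → S P ≤ L ^ t := by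
  obtain ⟨K, hK, h⟩ := h.bnd
  exact ⟨(max 1 K) ^ (1 / m), Bnd.one_le_threshold K hm, fun _ _ _ hP hR hT hL =>
    (h hP hR hT).le_rpow_of_le hR.hL (Bnd.const_le_rpow hm hL) het⟩

end UBnd

/-! ## The derived amplitudes -/

namespace StepPars

variable (c : StepConsts) (T : ℝ)

/-- Power counting of `Y`. [folklore] -/
theorem uY : UBnd T (fun P => P.Y c) (201 / 400000) := by
  apply UBnd.mono
  · simp only [StepPars.Y, div_eq_mul_inv]
    apply UBnd.max_one
    · exact ((UBnd.const T c.Cp).mul (UBnd.A T)).mul (UBnd.γi T)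
    · norm_num [B0]
  · norm_num [B0]

/-- Power counting of `A₀`. [folklore] -/
theorem uA₀ : UBnd T (fun P => P.A₀ c) (201 / 800000) :=
  ((UBnd.const T c.Ca).mul ((UBnd.γ T).mul (uY c T)).sqrt).mono (by norm_num)

/-- Power counting of `A₁`. [folklore] -/
theorem uA₁ : UBnd T (fun P => P.A₁ c) (1 / 16 + 201 / 200000) :=
  ((((UBnd.const T c.Ca).mul (UBnd.γ T).sqrt).mul ((uY c T).pow (n := 2))).mul (UBnd.Θ T)).mono (by norm_num)

/-- Power counting of `A₂`. [folklore] -/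
theorem uA₂ : UBnd T (fun P => P.A₂ c) (1 / 8 + 201 / 100000) :=
  ((((UBnd.const T c.Ca).mul (UBnd.γ T).sqrt).mul ((uY c T).pow (n := 4))).mul ((UBnd.Θ T).pow (n := 2))).mono
    (by norm_num)

/-- Power counting of `H₁`. [folklore] -/
theorem uH₁ : UBnd T (fun P => P.H₁ c) (1 / 16 + 201 / 200000) :=
  ((((UBnd.const T c.Ca).mul (UBnd.γ T)).mul ((uY c T).pow (n := 2))).mul (UBnd.Θ T)).mono (by norm_num)

/-- Power counting of `H₂`. [folklore] -/
theorem uH₂ : UBnd T (fun P => P.H₂ c) (1 / 8 + 201 / 100000) :=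
  ((((UBnd.const T c.Ca).mul (UBnd.γ T)).mul ((uY c T).pow (n := 4))).mul ((UBnd.Θ T).pow (n := 2))).mono (by norm_num)

/-! ## The sizes of the step -/

set_option maxHeartbeats 2000000 in
/-- Power counting of the new `L¹` stress. [cite: BuckmasterVicol2020, §7.7] -/
theorem uStepL1 : UBnd T (fun P => P.stepL1 c) (-(3 / 50)) := by
  apply UBnd.mono
  · simp only [StepPars.stepL1, StepPars.Ep, StepPars.Er, StepPars.Sc, StepPars.Lc, StepPars.EX, StepPars.Eζ,
      StepPars.Z, StepPars.LS, StepPars.Lp, StepPars.LdW, StepPars.LdX, StepPars.Lf₁, StepPars.Lf₂, StepPars.Lf₃,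
      Datum.wcSup, Datum.Keta, Datum.KetaD, D_σ, D_κ, D_μ, div_eq_mul_inv]
    -- structural power counting: leaves, constants, then products/sums/roots/powers
    repeat' (first
      | with_reducible exact UBnd.σr _ _ | with_reducible exact UBnd.κr _ _ | with_reducible exact UBnd.μr _ _
      | with_reducible exact UBnd.σn _ _ | with_reducible exact UBnd.κn _ _ | with_reducible exact UBnd.μn _ _
      | with_reducible exact UBnd.σ _ | with_reducible exact UBnd.κ _ | with_reducible exact UBnd.μ _
      | with_reducible exact UBnd.mup _ | with_reducible exact UBnd.σi _ | with_reducible exact UBnd.κi _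
      | with_reducible exact UBnd.μi _ | with_reducible exact UBnd.mupi _ | with_reducible exact UBnd.ℓ _
      | with_reducible exact UBnd.Θ _ | with_reducible exact UBnd.V _ | with_reducible exact UBnd.A _
      | with_reducible exact UBnd.γ _ | with_reducible exact UBnd.δ _ | with_reducible exact UBnd.γi _
      | with_reducible exact UBnd.Ti _
      | with_reducible exact uY _ _ | with_reducible exact uA₀ _ _ | with_reducible exact uA₁ _ _
      | with_reducible exact uA₂ _ _ | with_reducible exact uH₁ _ _ | with_reducible exact uH₂ _ _
      | with_reducible exact UBnd.const _ _
      | with_reducible apply UBnd.mul | with_reducible apply UBnd.add | with_reducible apply UBnd.sub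
      | with_reducible apply UBnd.sqrt | with_reducible apply UBnd.pow | with_reducible apply UBnd.rpow
      | norm_num)
  · simp only [B0, max_le_iff]
    norm_num

set_option maxHeartbeats 2000000 in
/-- Power counting of the new sup stress. [cite: BuckmasterVicol2020, §7.7] -/
theorem uStepSup : UBnd T (fun P => P.stepSup c) 5 := by
  apply UBnd.mono
  · simp only [StepPars.stepSup, StepPars.Sw, StepPars.Sp, StepPars.Sd, StepPars.SS, StepPars.Sf, StepPars.Φ,
      StepPars.Lf₂, StepPars.Lf₃,
      Datum.wSup, Datum.wpSup, Datum.wcSup, Datum.XSup, Datum.zSup, Datum.dFSup, Datum.dwpcSup, Datum.dXSup,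
      Datum.fastSup, Datum.dtwpcSup, D_σ, D_κ, D_μ, D_mup, div_eq_mul_inv]
    -- structural power counting: leaves, constants, then products/sums/roots/powers
    repeat' (first
      | with_reducible exact UBnd.σr _ _ | with_reducible exact UBnd.κr _ _ | with_reducible exact UBnd.μr _ _
      | with_reducible exact UBnd.σn _ _ | with_reducible exact UBnd.κn _ _ | with_reducible exact UBnd.μn _ _
      | with_reducible exact UBnd.σ _ | with_reducible exact UBnd.κ _ | with_reducible exact UBnd.μ _
      | with_reducible exact UBnd.mup _ | with_reducible exact UBnd.σi _ | with_reducible exact UBnd.κi _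
      | with_reducible exact UBnd.μi _ | with_reducible exact UBnd.mupi _ | with_reducible exact UBnd.ℓ _
      | with_reducible exact UBnd.Θ _ | with_reducible exact UBnd.V _ | with_reducible exact UBnd.A _
      | with_reducible exact UBnd.γ _ | with_reducible exact UBnd.δ _ | with_reducible exact UBnd.γi _
      | with_reducible exact UBnd.Ti _
      | with_reducible exact uY _ _ | with_reducible exact uA₀ _ _ | with_reducible exact uA₁ _ _
      | with_reducible exact uA₂ _ _ | with_reducible exact uH₁ _ _ | with_reducible exact uH₂ _ _
      | with_reducible exact UBnd.const _ _
      | with_reducible apply UBnd.mul | with_reducible apply UBnd.add | with_reducible apply UBnd.sub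
      | with_reducible apply UBnd.sqrt | with_reducible apply UBnd.pow)
  · simp only [B0, max_le_iff]
    norm_num

set_option maxHeartbeats 2000000 in
/-- Power counting of the `C¹` size of the new velocity. [cite: BuckmasterVicol2020, §7.7] -/
theorem uStepC1 : UBnd T (fun P => P.stepC0 c + 3 * P.stepC1 c + P.stepCt c) (31 / 8) := by
  apply UBnd.mono
  · simp only [StepPars.stepC0, StepPars.stepC1, StepPars.stepCt, StepPars.Sw,
      Datum.wSup, Datum.wpSup, Datum.wcSup, Datum.XSup, Datum.zSup, Datum.dFSup, Datum.dwSup, Datum.dwpcSup,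
      Datum.dXSup, Datum.zzSup, Datum.ddFSup, Datum.fastSup, Datum.dfastSup, Datum.ddfastSup, Datum.dtwSup,
      Datum.dtwpcSup, Datum.dtXSup, Datum.FdotSup, Datum.zdotSup, Datum.dFdotSup, Datum.ddirSup,
      D_σ, D_κ, D_μ, D_mup, div_eq_mul_inv]
    -- structural power counting: leaves, constants, then products/sums/roots/powers
    repeat' (first
      | with_reducible exact UBnd.σr _ _ | with_reducible exact UBnd.κr _ _ | with_reducible exact UBnd.μr _ _
      | with_reducible exact UBnd.σn _ _ | with_reducible exact UBnd.κn _ _ | with_reducible exact UBnd.μn _ _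
      | with_reducible exact UBnd.σ _ | with_reducible exact UBnd.κ _ | with_reducible exact UBnd.μ _
      | with_reducible exact UBnd.mup _ | with_reducible exact UBnd.σi _ | with_reducible exact UBnd.κi _
      | with_reducible exact UBnd.μi _ | with_reducible exact UBnd.mupi _ | with_reducible exact UBnd.ℓ _
      | with_reducible exact UBnd.Θ _ | with_reducible exact UBnd.V _ | with_reducible exact UBnd.A _
      | with_reducible exact UBnd.γ _ | with_reducible exact UBnd.δ _ | with_reducible exact UBnd.γi _
      | with_reducible exact UBnd.Ti _
      | with_reducible exact uY _ _ | with_reducible exact uA₀ _ _ | with_reducible exact uA₁ _ _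
      | with_reducible exact uA₂ _ _ | with_reducible exact uH₁ _ _ | with_reducible exact uH₂ _ _
      | with_reducible exact UBnd.const _ _
      | with_reducible apply UBnd.mul | with_reducible apply UBnd.add | with_reducible apply UBnd.sub
      | with_reducible apply UBnd.sqrt | with_reducible apply UBnd.pow)
  · simp only [B0, max_le_iff]
    norm_num

/-- Power counting of the mollification part of the `L²` increment. [cite: BuckmasterVicol2020, §7.7] -/
theorem uIncA : UBnd T (fun P => c.Cp * (P.V + P.V) * P.ℓ) (-(1 / 20)) :=
  (((UBnd.const T c.Cp).mul ((UBnd.V T).add (UBnd.V T))).mul (UBnd.ℓ T)).mono (by norm_num [B0])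

set_option maxHeartbeats 2000000 in
/-- Power counting of the corrector energy. [cite: BuckmasterVicol2020, §7.7] -/
theorem uEr : UBnd T (fun P => P.Er c) (-(1 / 4)) := by
  apply UBnd.mono
  · simp only [StepPars.Er, StepPars.Sc, StepPars.Lc, StepPars.EX, StepPars.Eζ, StepPars.Z, Datum.wcSup,
      D_σ, D_κ, div_eq_mul_inv]
    -- structural power counting: leaves, constants, then products/sums/roots/powers
    repeat' (first
      | with_reducible exact UBnd.σr _ _ | with_reducible exact UBnd.κr _ _ | with_reducible exact UBnd.μr _ _
      | with_reducible exact UBnd.σn _ _ | with_reducible exact UBnd.κn _ _ | with_reducible exact UBnd.μn _ _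
      | with_reducible exact UBnd.σ _ | with_reducible exact UBnd.κ _ | with_reducible exact UBnd.μ _
      | with_reducible exact UBnd.mup _ | with_reducible exact UBnd.σi _ | with_reducible exact UBnd.κi _
      | with_reducible exact UBnd.μi _ | with_reducible exact UBnd.mupi _ | with_reducible exact UBnd.ℓ _
      | with_reducible exact UBnd.Θ _ | with_reducible exact UBnd.V _ | with_reducible exact UBnd.A _
      | with_reducible exact UBnd.γ _ | with_reducible exact UBnd.δ _ | with_reducible exact UBnd.γi _
      | with_reducible exact UBnd.Ti _
      | with_reducible exact uY _ _ | with_reducible exact uA₀ _ _ | with_reducible exact uA₁ _ _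
      | with_reducible exact uA₂ _ _ | with_reducible exact uH₁ _ _ | with_reducible exact uH₂ _ _
      | with_reducible exact UBnd.const _ _
      | with_reducible apply UBnd.mul | with_reducible apply UBnd.add | with_reducible apply UBnd.sub
      | with_reducible apply UBnd.sqrt | with_reducible apply UBnd.pow)
  · norm_num [max_le_iff]

/-- Power counting of the corrector part of the `L²` increment. [cite: BuckmasterVicol2020, §7.7] -/
theorem uIncC : UBnd T (fun P => Real.sqrt (P.Er c)) (-(1 / 8)) :=
  (uEr c T).sqrt.mono (by norm_num)

/-! ## The principal part of the `L²` increment (an absolute constant) -/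

/-- The absolute constant of the energy of `wp`. [folklore] -/
def M₁ : ℝ := Real.sqrt (NN * (5 * (2 / radius (Fin 3) * (1 + 3 * c.Cp) + 3 * (c.Ca * (1 + c.Cp) ^ 2) * Real.sqrt 3)))

variable {c T} {P : StepPars} {L lam : ℝ}

/-- `Y² Θ σ⁻¹ ≤ (1 + C_p)²` in the regime. [folklore] -/
theorem Y_sq_Θ_div_σ_le (hc : c.Valid) (hP : P.Valid) (hR : P.Regime L lam) :
    P.Y c ^ 2 * P.Θ * (P.σ : ℝ)⁻¹ ≤ (1 + c.Cp) ^ 2 := by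
  have hL := hR.hL
  have hL0 : 0 < L := by linarith
  have hCp : 0 ≤ c.Cp := by linarith [hc.hCp]
  have hγ := hP.hγ
  -- `Y ≤ (1 + C_p) L^{y}`
  have hy : P.Y c ≤ (1 + c.Cp) * L ^ (201 / 400000 : ℝ) := by
    have h1 : c.Cp * P.A / P.γ₀ ≤ c.Cp * L ^ (201 / 400000 : ℝ) := by
      rw [div_eq_mul_inv, mul_assoc]
      refine mul_le_mul_of_nonneg_left ?_ hCp
      have hA : P.A ≤ L ^ ((10 : ℝ) / B0) := by rw [hR.hA]; exact_mod_cast hR.lam_pow_le 10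
      have hγi := hR.inv_γ_le hP
      calc P.A * P.γ₀⁻¹ ≤ L ^ ((10 : ℝ) / B0) * L ^ (1 / (20 * B0)) :=
            mul_le_mul hA hγi (inv_pos.2 hγ).le (Real.rpow_nonneg hL0.le _)
        _ = L ^ (201 / 400000 : ℝ) := by rw [← Real.rpow_add hL0]; norm_num [B0]
    have h2 : 1 ≤ L ^ (201 / 400000 : ℝ) := Real.one_le_rpow hL (by norm_num)
    refine max_le (by nlinarith) (h1.trans ?_)
    nlinarith
  have hY0 : 0 ≤ P.Y c := le_trans zero_le_one (le_max_left _ _)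
  have hY2 : P.Y c ^ 2 ≤ (1 + c.Cp) ^ 2 * L ^ (201 / 200000 : ℝ) := by
    calc P.Y c ^ 2 ≤ ((1 + c.Cp) * L ^ (201 / 400000 : ℝ)) ^ 2 := pow_le_pow_left₀ hY0 hy 2
      _ = (1 + c.Cp) ^ 2 * L ^ (201 / 200000 : ℝ) := by
          rw [mul_pow, ← Real.rpow_natCast (L ^ (201 / 400000 : ℝ)) 2, ← Real.rpow_mul hL0.le]; norm_num
  have hΘσ : P.Θ * (P.σ : ℝ)⁻¹ = L ^ (-(1 / 8 : ℝ)) := by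
    rw [hR.hΘ, hR.hσ, ← Real.rpow_neg hL0.le, ← Real.rpow_add hL0]; norm_num
  have hneg : L ^ (201 / 200000 : ℝ) * L ^ (-(1 / 8 : ℝ)) ≤ 1 := by
    rw [← Real.rpow_add hL0]
    exact Real.rpow_le_one_of_one_le_of_nonpos hL (by norm_num)
  calc P.Y c ^ 2 * P.Θ * (P.σ : ℝ)⁻¹ = P.Y c ^ 2 * (P.Θ * (P.σ : ℝ)⁻¹) := by ring
    _ ≤ (1 + c.Cp) ^ 2 * L ^ (201 / 200000 : ℝ) * L ^ (-(1 / 8 : ℝ)) := by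
        rw [hΘσ]; exact mul_le_mul_of_nonneg_right hY2 (Real.rpow_nonneg hL0.le _)
    _ = (1 + c.Cp) ^ 2 * (L ^ (201 / 200000 : ℝ) * L ^ (-(1 / 8 : ℝ))) := by ring
    _ ≤ (1 + c.Cp) ^ 2 := mul_le_of_le_one_right (by positivity) hneg

/-- **`√Ep ≤ M₁ √γ₀`**: the principal part of the `L²` increment (2.8). [cite: BuckmasterVicol2019Annals, (2.8)] -/
theorem sqrt_Ep_le (hc : c.Valid) (hP : P.Valid) (hR : P.Regime L lam) :
    Real.sqrt (P.Ep c) ≤ M₁ c * Real.sqrt P.γ₀ := by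
  have hCp : 0 ≤ c.Cp := by linarith [hc.hCp]
  have hCa := hc.hCa
  have hγ := hP.hγ
  have hr : 0 < radius (Fin 3) := radius_pos Datum.hd3
  have hN : 0 ≤ NN := le_trans zero_le_one one_le_NN
  have key := Y_sq_Θ_div_σ_le hc hP hR
  have h1 : P.γ₀ + 3 * (c.Cp * P.δ) ≤ (1 + 3 * c.Cp) * P.γ₀ := by
    have := hR.hδγ; nlinarith
  have h2 : 3 * P.H₁ c * (Real.sqrt 3 / P.σ) ≤ 3 * (c.Ca * (1 + c.Cp) ^ 2) * Real.sqrt 3 * P.γ₀ := by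
    have e : 3 * P.H₁ c * (Real.sqrt 3 / P.σ) = 3 * (c.Ca * (P.Y c ^ 2 * P.Θ * (P.σ : ℝ)⁻¹)) * Real.sqrt 3 * P.γ₀ := by
      simp only [StepPars.H₁, div_eq_mul_inv]; ring
    rw [e]
    have h3 : 0 ≤ Real.sqrt 3 := Real.sqrt_nonneg 3
    have : c.Ca * (P.Y c ^ 2 * P.Θ * (P.σ : ℝ)⁻¹) ≤ c.Ca * (1 + c.Cp) ^ 2 := mul_le_mul_of_nonneg_left key hCa
    have : 3 * (c.Ca * (P.Y c ^ 2 * P.Θ * (P.σ : ℝ)⁻¹)) * Real.sqrt 3 ≤ 3 * (c.Ca * (1 + c.Cp) ^ 2) * Real.sqrt 3 := by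
      nlinarith
    exact mul_le_mul_of_nonneg_right this hγ.le
  have hEp : P.Ep c ≤ M₁ c ^ 2 * P.γ₀ := by
    have e : M₁ c ^ 2 * P.γ₀ = NN * (5 * (2 / radius (Fin 3) * ((1 + 3 * c.Cp) * P.γ₀) + 3 * (c.Ca * (1 + c.Cp) ^ 2) * Real.sqrt 3 * P.γ₀)) := by
      unfold M₁
      rw [Real.sq_sqrt (by positivity)]
      ring
    rw [e]
    unfold StepPars.Ep
    have hr2 : 0 ≤ 2 / radius (Fin 3) := by positivity
    have := mul_le_mul_of_nonneg_left h1 hr2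
    nlinarith
  calc Real.sqrt (P.Ep c) ≤ Real.sqrt (M₁ c ^ 2 * P.γ₀) := Real.sqrt_le_sqrt hEp
    _ = M₁ c * Real.sqrt P.γ₀ := by rw [Real.sqrt_mul (sq_nonneg _), Real.sqrt_sq (by unfold M₁; positivity)]

/-! ## The parameter choice: the four inductive bounds of the step -/

/-- **The arithmetic of the step.** For admissible constants there is an absolute `M > 0`, and for
every time horizon `T` a threshold `L₀`, such that in the regime at frequency `L ≥ L₀` the
bounds produced by `JetStep.jet_step` are: `L²` increment `≤ M √γ₀ = M δ_{q+1}^{1/2}` (2.8),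
`L¹` stress `≤ L^{-11/200}` (`= λ_{q+1}^{-1/20 - 1/200} ≤ λ_{q+1}^{-ε_R} δ_{q+2}`, (2.4)), sup
stress `≤ L^{10}` (2.5), `C¹` size `≤ L⁴` (2.3). [cite: BuckmasterVicol2020, §7.7] -/
theorem step_arith (hc : c.Valid) : ∃ M : ℝ, 0 < M ∧ ∀ T : ℝ, ∃ L₀ : ℝ, 1 ≤ L₀ ∧
    ∀ ⦃P : StepPars⦄ ⦃L lam : ℝ⦄, P.Valid → P.Regime L lam → P.T = T → L₀ ≤ L →
      P.stepInc c ≤ M * Real.sqrt P.γ₀ ∧ P.stepL1 c ≤ L ^ (-(11 / 200 : ℝ)) ∧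
      P.stepSup c ≤ L ^ (10 : ℝ) ∧ P.stepC0 c + 3 * P.stepC1 c + P.stepCt c ≤ L ^ (4 : ℝ) := by
  have hM₁ : 0 ≤ M₁ c := Real.sqrt_nonneg _
  refine ⟨2 + M₁ c, by linarith, fun T => ?_⟩
  obtain ⟨L₁, hL₁, h₁⟩ := (uStepL1 c T).le_rpow (m := 1 / 200) (t := -(11 / 200)) (by norm_num) (by norm_num)
  obtain ⟨L₂, hL₂, h₂⟩ := (uStepSup c T).le_rpow (m := 5) (t := 10) (by norm_num) (by norm_num)
  obtain ⟨L₃, hL₃, h₃⟩ := (uStepC1 c T).le_rpow (m := 1 / 8) (t := 4) (by norm_num) (by norm_num)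
  obtain ⟨L₄, hL₄, h₄⟩ := (uIncA c T).le_rpow (m := 1 / 40) (t := -(1 / 40)) (by norm_num) (by norm_num)
  obtain ⟨L₅, hL₅, h₅⟩ := (uIncC c T).le_rpow (m := 1 / 16) (t := -(1 / 16)) (by norm_num) (by norm_num)
  refine ⟨max (max L₁ L₂) (max L₃ (max L₄ L₅)), le_max_of_le_left (le_max_of_le_left hL₁), fun P L _ hP hR hT hL => ?_⟩
  have hL1 := hR.hL
  have e₁ : L₁ ≤ L := le_trans (le_max_of_le_left (le_max_left _ _)) hL
  have e₂ : L₂ ≤ L := le_trans (le_max_of_le_left (le_max_right _ _)) hL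
  have e₃ : L₃ ≤ L := le_trans (le_max_of_le_right (le_max_left _ _)) hL
  have e₄ : L₄ ≤ L := le_trans (le_max_of_le_right (le_max_of_le_right (le_max_left _ _))) hL
  have e₅ : L₅ ≤ L := le_trans (le_max_of_le_right (le_max_of_le_right (le_max_right _ _))) hL
  refine ⟨?_, h₁ hP hR hT e₁, h₂ hP hR hT e₂, h₃ hP hR hT e₃⟩
  have hs := hR.rpow_le_sqrt_γ
  have hA : c.Cp * (P.V + P.V) * P.ℓ ≤ Real.sqrt P.γ₀ :=
    (h₄ hP hR hT e₄).trans ((Real.rpow_le_rpow_of_exponent_le hL1 (by norm_num [B0])).trans hs)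
  have hC : Real.sqrt (P.Er c) ≤ Real.sqrt P.γ₀ :=
    (h₅ hP hR hT e₅).trans ((Real.rpow_le_rpow_of_exponent_le hL1 (by norm_num [B0])).trans hs)
  have hB := sqrt_Ep_le hc hP hR
  unfold StepPars.stepInc
  linarith

/-! ## Admissibility of the parameter choice -/

/-- **The side conditions of the step hold for `L` large**: `ℓ = L^{-1/16} ≤ 1/4`, `8ℓ ≤ T`,
`μ = L^{13/16} ≥ 60`, `κ = L^{1/2} ≥ 1`, `μ′ > 0`. [folklore] -/
theorem exists_threshold_valid {T : ℝ} (hT : 0 < T) : ∃ L₁ : ℝ, 1 ≤ L₁ ∧ ∀ L : ℝ, L₁ ≤ L →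
    L ^ (-(1 / 16 : ℝ)) ≤ 1 / 4 ∧ 8 * L ^ (-(1 / 16 : ℝ)) ≤ T ∧ pipeConc ≤ L ^ (13 / 16 : ℝ) ∧
    1 ≤ L ^ (1 / 2 : ℝ) ∧ 0 < L ^ (5 / 4 : ℝ) := by
  refine ⟨max (max ((4 : ℝ) ^ (16 : ℝ)) ((8 / T) ^ (16 : ℝ))) (pipeConc ^ (16 / 13 : ℝ)), ?_, fun L hL => ?_⟩
  · refine le_max_of_le_left (le_max_of_le_left ?_)
    exact Real.one_le_rpow (by norm_num) (by norm_num)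
  have h4 : (4 : ℝ) ^ (16 : ℝ) ≤ L := le_trans (le_max_of_le_left (le_max_left _ _)) hL
  have h8 : (8 / T) ^ (16 : ℝ) ≤ L := le_trans (le_max_of_le_left (le_max_right _ _)) hL
  have h60 : pipeConc ^ (16 / 13 : ℝ) ≤ L := le_trans (le_max_right _ _) hL
  have hL1 : 1 ≤ L := le_trans (Real.one_le_rpow (by norm_num) (by norm_num)) h4
  have hL0 : 0 < L := by linarith
  have hpc : 0 ≤ pipeConc := le_trans zero_le_one one_le_pipeConc
  -- `L^{-1/16} ≤ x` iff `x⁻¹ ^ 16 ≤ L`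
  have key : ∀ x : ℝ, 0 < x → x⁻¹ ^ (16 : ℝ) ≤ L → L ^ (-(1 / 16 : ℝ)) ≤ x := by
    intro x hx hxL
    have h1 : (x⁻¹ ^ (16 : ℝ)) ^ (1 / 16 : ℝ) ≤ L ^ (1 / 16 : ℝ) := Real.rpow_le_rpow (by positivity) hxL (by norm_num)
    rw [← Real.rpow_mul (by positivity), show (16 : ℝ) * (1 / 16) = 1 by norm_num, Real.rpow_one] at h1
    rw [Real.rpow_neg hL0.le]
    have h2 : 0 < L ^ (1 / 16 : ℝ) := Real.rpow_pos_of_pos hL0 _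
    calc (L ^ (1 / 16 : ℝ))⁻¹ ≤ (x⁻¹)⁻¹ := (inv_le_inv₀ h2 (by positivity)).2 h1
      _ = x := inv_inv x
  refine ⟨key (1 / 4) (by norm_num) (by rwa [one_div, inv_inv]), ?_, ?_, Real.one_le_rpow hL1 (by norm_num), Real.rpow_pos_of_pos hL0 _⟩
  · have h := key (T / 8) (by positivity) (by rwa [inv_div])
    linarith
  · calc pipeConc = (pipeConc ^ (16 / 13 : ℝ)) ^ (13 / 16 : ℝ) := by
          rw [← Real.rpow_mul hpc]; norm_num
      _ ≤ L ^ (13 / 16 : ℝ) := Real.rpow_le_rpow (by positivity) h60 (by norm_num)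

end StepPars

end JetStep

end Literature.Analysis.FluidPDE
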